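import Summits.BirchSwinnertonDyer.BirchSwinnertonDyer.Theorems.PrintCFramBottomClassIndexLawFiveLeRegularLocusBSDp
import HarnessLib

/-!
# Crux `PrintCFram.BottomClassIndexLawFiveLe` (stmt-BirchSwinnertonDyer-20372), line `eisenstein-resource-bdp-line` (registry v25):
# the genus-internal branch, file 1 — EXACT CONTROL AND THE TWO INDEX HALVES AT A REGULAR KRIZ–LI DATUM, ORIENTATION-FREE

Cell `bsd-print-cfram`, width seat `bsd-line-cfram-p1-w7` (g7); `--supports stmt-BirchSwinnertonDyer-20372` (helper). THEOREMS ONLY;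
no definition, no named fact, no `sorry`. BSD is not proved by any of this; no summit statement is proved by this seat; the crux stays
OPEN and no registered stub is closed.

WHAT THIS FILE IS. LEAD g3's exact anticyclotomic control `EisensteinResourceBdpLine.additiveControl_heegner_of_cmRamified` and LEAD g5's
two index halves `RegularLocus.indexHalves_cmRamified_of_regularKrizLiDatum` carry a binder `L(W^{(d_K)},1) ≠ 0` that their proofs never
use — it only records the registry's ORIENTATION (the curve with the Heegner datum is the rank-one curve, its twist by `d_K` the rank-zero
partner). Ideator bsd-idea-7 g19's crux idea `genus-internal-heegner-fields` (critic idea-crit-10 g5 V#146 / V#146b) needs the OTHER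
orientation: Kriz–Li's Thm. 1.20 at a Heegner field `K` of a STRIPPED curve `V` of analytic rank zero whose twist `V^{(d_K)}` carries the
rank. This file restates the two theorems VERBATIM without the idle binder (`additiveControl_heegner_of_cmRamified'`,
`indexHalves_cmRamified_of_regularKrizLiDatum'`); the sequel `…GenusInternalStrippedDatumBSDp` turns the two halves into the swapped
display (Manin-robust) and `BSD_p` of the rank-one twist. CONDITIONAL on the named facts displayed as hypotheses; beyond-print theorem: NO.
References: [KrizLi2019] Thm. 1.20, Rem. 1.17, Rem. 1.21; [JetchevSkinnerWan2017] §7.4.1, Thm. 3.3.1; [Hsieh2014] Thm. A;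
[LiuZhangZhang2018] Thms. 1.5.1/1.5.3; [CastellaGrossiLeeSkinner2022] Thm. 5.3.1; [Kolyvagin1990] Thm. A.
-/

set_option autoImplicit false
-- the summit namespace `Summit.BirchSwinnertonDyer.BirchSwinnertonDyer` repeats the problem name by design (D-0017)
set_option linter.dupNamespace false

noncomputable section

open scoped Classical

namespace Summit.BirchSwinnertonDyer.BirchSwinnertonDyer.Theorems.PrintCFram.GenusInternal

/-! ## §1 Exact control and the two index halves WITHOUT the orientation binder -/

section Halves

open WeierstrassCurve NumberField IsDedekindDomain Field PowerSeries
  Literature.NumberTheory.EllipticCurves Literature.NumberTheory.EllipticCurves.GreenbergSelmer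
  Literature.NumberTheory.EllipticCurves.GreenbergVatsal2000
  Literature.NumberTheory.EllipticCurves.ModularForms
  Literature.NumberTheory.EllipticCurves.KrizLi2019
  Literature.NumberTheory.GaloisCohomology
  Literature.NumberTheory.EllipticCurves.Rank1Residual
  Literature.NumberTheory.EllipticCurves.Rank1Residual.Typed
  Literature.NumberTheory.GaloisRepresentations
  Summit.BirchSwinnertonDyer.Rank1Residual
  Summit.BirchSwinnertonDyer.Rank1Residual.Additive
  Summit.BirchSwinnertonDyer.Rank1Residual.X11b Summit.BirchSwinnertonDyer.Rank1Residual.X11b.AcSelmer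
  Summit.BirchSwinnertonDyer.Rank1Residual.X11b.Halves
  Summit.BirchSwinnertonDyer.Rank1Residual.X12
  Summit.BirchSwinnertonDyer.Rank1Residual.X2.ResidualDevissageModules
  Summit.BirchSwinnertonDyer.BirchSwinnertonDyer.Theses.UniversalToricDescent
  Summit.BirchSwinnertonDyer.BirchSwinnertonDyer.Theorems
  Summit.BirchSwinnertonDyer.BirchSwinnertonDyer.Theorems.SchneiderFree
  Summit.BirchSwinnertonDyer.BirchSwinnertonDyer.Theorems.UniversalToricDescentWaldspurgerFlat
  Summit.BirchSwinnertonDyer.BirchSwinnertonDyer.Theorems.UniversalToricDescentStrictPlace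
  Summit.BirchSwinnertonDyer.BirchSwinnertonDyer.Theorems.RamifiedSevenEllipticUnits
  Summit.BirchSwinnertonDyer.BirchSwinnertonDyer.Theorems.PrintCFram
  Summit.BirchSwinnertonDyer.BirchSwinnertonDyer.Theorems.PrintCFram.EisensteinResourceBdpLine
  Summit.BirchSwinnertonDyer.BirchSwinnertonDyer.Theorems.PrintCFram.RegularLocus

variable {p : ℕ} [Fact p.Prime]

/-- **Exact anticyclotomic control at the CM-ramified additive prime, Heegner-datum form, ORIENTATION-FREE** — LEAD g3's
`EisensteinResourceBdpLine.additiveControl_heegner_of_cmRamified` VERBATIM without its (unused) binder `L(W^{(d_K)},1) ≠ 0`: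
the `E(ℚ_p)[p] = 0` door `additiveControlOnTreeAt_of_facts_of_noPTorsionPadic'` with `W(ℚ_p)[p] = 0`
(`prime_nsmul_eq_zero_padic_of_hasCM_of_cmRamified`), `p` split in `K` from the Heegner hypothesis, rank one and finite Ш over `K`
from Kolyvagin at the non-torsion Heegner point. Whether the rank over `ℚ` sits in `W` or in `W^{(d_K)}` is irrelevant.
[cite: JetchevSkinnerWan2017, Thm. 3.3.1 (arXiv:1512.06894 p. 11)] [cite: MilneADT2006, Ch. I, Thm. 4.10 and Thm. 2.8]
[cite: Kolyvagin1990, Thm. A] -/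
theorem additiveControl_heegner_of_cmRamified'
    (hPT : ∀ (K : Type) [Field K] [NumberField K], poitouTate_selmerStructure_duality K)
    (hPT2 : ∀ (K : Type) [Field K] [NumberField K], poitouTate_sha_tateDual K)
    (hEP : ∀ (K : Type) [Field K] [NumberField K] (v : HeightOneSpectrum (𝓞 K)),
      localEulerPoincareCharacteristic (v.adicCompletion K))
    (hcd : fieldCdLE_two_of_numberField)
    (hBr : ∀ (K : Type) [Field K] [NumberField K] (p : ℕ) [Fact p.Prime],
      ZpExtension.decomp_not_le_kerSubgroup_of_isAnticyclotomic K p)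
    (W : WeierstrassCurve ℚ) [W.IsElliptic] [W.IsGloballyMinimal] (hCM : W.HasCM) (hram : CMRamified W p) (h5 : 5 ≤ p) :
    ∀ (N : ℕ) [NeZero N] (K : Type) [Field K] [NumberField K] (Dt : ModularParametrizationData W N)
      (H : HeegnerDatum N (NumberField.discr K)) (ι : K →+* ℂ) (P : (W.baseChange K).toAffine.Point),
      W.conductorNorm ℤ = N → IsImaginaryQuadratic K → SatisfiesHeegnerHypothesis N K →
      WeierstrassCurve.Affine.Point.map ι.toRatAlgHom P = heegnerPointComplex Dt H → ¬ IsOfFinAddOrder P →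
      Literature.NumberTheory.EllipticCurves.kolyvagin N W K →
      ∀ (κ : ZpExtension K p), κ.IsAnticyclotomic → ∀ (γ : Field.absoluteGaloisGroup K) [Fact (κ.IsTopGenerator γ)]
        (𝔭 : HeightOneSpectrum (𝓞 K)) (h𝔭 : ((p : ℕ) : 𝓞 K) ∈ 𝔭.asIdeal) (he : 𝔭.asIdeal.ramificationIdx (𝓞 ℚ) = 1)
        (hf : 𝔭.asIdeal.inertiaDeg (𝓞 ℚ) = 1),
        SchneiderFree.AdditiveControlOnTreeAt p κ 𝔭 γ (embAt K p 𝔭 h𝔭 he hf) P := by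
  intro N _ K _ _ Dt H ι P hN hK hHe hP hnt hKo κ hκ γ _ 𝔭 h𝔭 he hf
  have hp2 : p ≠ 2 := by omega
  have hadd : Addv W p := addv_of_cmRamified W hCM hram h5
  have hpN : p ∣ W.conductorNorm ℤ := (W.dvd_conductorNorm_iff_not_hasGoodReductionAtPrime p).mpr hadd.1
  have hsplit : SplitsIn K p := SchneiderFreeAdditiveX3.splitsIn_of_satisfiesHeegnerHypothesis hN hHe hpN
  obtain ⟨hrank, hSha⟩ := hKo hK hHe ⟨Dt, H, ι, hP⟩ hnt
  exact AdditivePotSupersingularControl.additiveControlOnTreeAt_of_facts_of_noPTorsionPadic' hPT hPT2 hEP hcd hBr W p hp2 hadd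
    (prime_nsmul_eq_zero_padic_of_hasCM_of_cmRamified W p hCM h5 hram) K hK hsplit κ hκ γ 𝔭 h𝔭 he hf hrank hSha P hnt

/-- **Both index halves at slack `v_p(c)` at a REGULAR KRIZ–LI DATUM of the CM-ramified class, ORIENTATION-FREE** — LEAD g5's
`RegularLocus.indexHalves_cmRamified_of_regularKrizLiDatum` VERBATIM without the binder `L(W^{(d_K)},1) ≠ 0` (used there only through
the control theorem, which ignores it). Inputs BY NAME: Hsieh 2014 Thm. A (`hA`), Liu–Zhang–Zhang 2018 (`hL`), Poitou–Tate for Ш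
(`hPT2`), Kolyvagin (`hKo`), Kriz–Li 2019 Thm. 1.20 (`hKL`); the four control facts are tree theorems (`prints_four_hold`). Data:
`W` CM, `p ≥ 5` CM-ramified; a Heegner datum `(N = N_W, K, Dt, H, ι, P)` with `d_K < −4` and `P` non-torsion; Kriz–Li's binders at
`(W, p)` and `K` with (1), (3), (4); an anticyclotomic frame `(κ, γ, 𝔭 ∋ p)` with a regular residual line (`hreg`). Conclusion:
`IndexLowerBoundLeAt W p K P (v_p c) ∧ Upper.IndexUpperBoundLeAt W p K P (v_p c)`: `n = 0` at the frame
(`hasCharValuationAt_zero_cmRamified_of_regular`), the UPPER socket from the integral ♭-frame value (Hsieh + LZZ), the LOWER socket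
from Kriz–Li Thm. 1.20, exact control (previous theorem), the K1 links.
[cite: KrizLi2019, Thm. 1.20 (pp. 7–8), Rem. 1.17 (p. 6), Rem. 1.21 (p. 8)] [cite: JetchevSkinnerWan2017, §7.4.1 (arXiv:1512.06894 p. 30)]
[cite: Hsieh2014, Thm. A p. 712 (Doc. Math. 19)] [cite: LiuZhangZhang2018, Thm 1.5.1 and Thm 1.5.3 (Duke Math. J. 167 pp. 748–749)] -/
theorem indexHalves_cmRamified_of_regularKrizLiDatum'
    (hA : Hsieh2014.thmA_exists_isHsiehLFunction_unrPeriod_anyLevel)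
    (hL : LiuZhangZhang2018.thm151_thm153_modularCurve_heegnerVector_additive)
    (hPT2 : ∀ (K : Type) [Field K] [NumberField K], poitouTate_sha_tateDual K)
    (hKo : ∀ (N : ℕ) [NeZero N] (W : WeierstrassCurve ℚ) (K : Type) [Field K] [NumberField K],
      Literature.NumberTheory.EllipticCurves.kolyvagin N W K)
    (hKL : KrizLi2019.thm120_padicLogHeegner_unit_of_bernoulli)
    (W : WeierstrassCurve ℚ) [W.IsElliptic] [W.IsGloballyMinimal] (hCM : W.HasCM) (hram : CMRamified W p) (h5 : 5 ≤ p)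
    (N : ℕ) [NeZero N] (K : Type) [Field K] [NumberField K]
    (Dt : ModularParametrizationData W N) (H : HeegnerDatum N (NumberField.discr K)) (ι : K →+* ℂ)
    (P : (W.baseChange K).toAffine.Point)
    (hN : W.conductorNorm ℤ = N) (hK : IsImaginaryQuadratic K) (hHN : SatisfiesHeegnerHypothesis N K)
    (hd4 : NumberField.discr K < -4)
    (hP : WeierstrassCurve.Affine.Point.map ι.toRatAlgHom P = heegnerPointComplex Dt H) (hnt : ¬ IsOfFinAddOrder P)
    -- Kriz–Li's binders at `(W, p)`
    (f : ℕ) [NeZero f] (ψ : DirichletCharacter ℚ_[p] f) (ω : DirichletCharacter ℚ_[p] p)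
    (hψ : ψ.IsPrimitive) (hω : KrizLi2019.IsTeichmullerCharacter ω)
    (hss : ∀ ℓ : ℕ, ℓ.Prime → ¬ (ℓ ∣ p * W.conductorNorm ℤ) →
      ‖((W.LFunction ℓ : ℤ) : ℚ_[p]) - (ψ (ℓ : ZMod f) + ψ⁻¹ (ℓ : ZMod f) * ω (ℓ : ZMod p))‖ < 1)
    (h1 : ψ (p : ZMod f) ≠ 1) (h1' : KrizLi2019.primVal (KrizLi2019.invMulOmega ψ ω) p ≠ 1)
    (h3 : ∀ ℓ : ℕ, (hℓ : ℓ.Prime) → ℓ ≠ p →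
      (haveI := Fact.mk hℓ; ¬ W.HasGoodReductionAtPrime ℓ ∧ ¬ W.HasMultiplicativeReductionAtPrime ℓ) →
      ψ (ℓ : ZMod f) ≠ 1 ∧ KrizLi2019.primVal (KrizLi2019.invMulOmega ψ ω) ℓ ≠ 1)
    -- Kriz–Li's binders at `K`
    (εK : DirichletCharacter ℚ_[p] (NumberField.discr K).natAbs) (hεK : KrizLi2019.IsKroneckerCharacterOf K εK)
    (h4 : ¬ (‖KrizLi2019.bernoulliOnePrim (KrizLi2019.bernoulliCharOne ψ εK) *
        KrizLi2019.bernoulliOnePrim (KrizLi2019.bernoulliCharTwo ψ εK ω)‖ ≤ (p : ℝ)⁻¹))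
    -- the regular frame
    (κ : ZpExtension K p) (hκ : κ.IsAnticyclotomic) (γ : Field.absoluteGaloisGroup K) [Fact (κ.IsTopGenerator γ)]
    (𝔭 : HeightOneSpectrum (𝓞 K)) (h𝔭 : ((p : ℕ) : 𝓞 K) ∈ 𝔭.asIdeal)
    (hreg : ∃ Φ : X2.ResidualDevissageModules.StableSubgroup (absoluteGaloisGroup K) ((W.baseChange K).geomTorsion (p : ℤ)),
      (∀ y : Φ.Quot, (∀ g : ↥(κ.kerSubgroup ⊓ decomp 𝔭), g • y = y) → y = 0) ∧
      Nat.card (datumStrictSelmer κ.kerSubgroup Φ.Sub p (AcSelmer.bdpData Φ.Sub p 𝔭)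
          {v : HeightOneSpectrum (𝓞 K) | ¬ (W.baseChange K).HasGoodReductionAt v ∧ ((p : ℕ) : 𝓞 K) ∉ v.asIdeal}) = 1 ∧
      Nat.card (datumStrictSelmer κ.kerSubgroup Φ.Quot p (AcSelmer.bdpData Φ.Quot p 𝔭)
          {v : HeightOneSpectrum (𝓞 K) | ¬ (W.baseChange K).HasGoodReductionAt v ∧ ((p : ℕ) : 𝓞 K) ∉ v.asIdeal}) = 1) :
    IndexLowerBoundLeAt W p K P (padicValNat p Dt.c.natAbs) ∧
      Upper.IndexUpperBoundLeAt W p K P (padicValNat p Dt.c.natAbs) := by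
  have hp : p.Prime := Fact.out
  have hp2 : p ≠ 2 := by omega
  obtain ⟨hPT, hEP, hcd, hBr⟩ := EisensteinResourceBdpLine.prints_four_hold
  have hadd : Addv W p := addv_of_cmRamified W hCM hram h5
  have hpN : p ∣ N := by
    rw [← hN]; exact (W.dvd_conductorNorm_iff_not_hasGoodReductionAtPrime p).mpr hadd.1
  have hp2N : p ^ 2 ∣ N := by
    rw [← hN]
    by_contra h
    rcases hasGoodReductionAtPrime_or_hasMultiplicativeReductionAtPrime_of_not_sq_dvd_conductorNorm (V := W) h
      with hg | hm
    · exact hadd.1 hg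
    · exact hadd.2 hm
  obtain ⟨he, hf⟩ := degreeOne_of_dvd_of_heegner hK hHN hpN h𝔭
  obtain ⟨_, hfin⟩ := hKo N W K hK hHN ⟨Dt, H, ι, hP⟩ hnt
  -- control exponent `n = 0` at the regular frame
  have h0 : XAc.HasCharValuationAt (W.baseChange K) p κ 𝔭 ∅ γ 0 :=
    hasCharValuationAt_zero_cmRamified_of_regular W hCM hram h5 hN hK hHN κ γ 𝔭 h𝔭 hreg
  -- exact control at the frame (the `W(ℚ_p)[p] = 0` door), orientation-free form
  have hCtl : AdditiveControlOnTreeAt p κ 𝔭 γ (embAt K p 𝔭 h𝔭 he hf) P :=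
    additiveControl_heegner_of_cmRamified' hPT hPT2 hEP hcd hBr W hCM hram h5 N K Dt H ι P hN hK hHN hP hnt
      (hKo N W K) κ hκ γ 𝔭 h𝔭 he hf
  -- the ♭-frame at `𝔭` and its integral value (Hsieh + LZZ)
  obtain ⟨ι₀⟩ := PadicAlgCl.nonempty_ringEquiv_complex p
  obtain ⟨ι', -, hind⟩ := exists_datum_forall_mem_iff p ι₀ hK h𝔭
  obtain ⟨ΩK, Ωp', Q, -, -, u, hu, hval⟩ :=
    exists_frameInt_value_manin hA hL W K 𝔭 κ γ Dt H ι P hp2 hN hp2N hK hd4 h𝔭 he hf hHN hκ hP hnt ι' hind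
  have hc0 : Dt.c ≠ 0 := Dt.maninConstant_ne_zero_holds
  have hlog : logOmega W p (embAt K p 𝔭 h𝔭 he hf) P ≠ 0 := X11b.R1.logOmega_ne_zero W p _ hnt
  -- UPPER socket from `n = 0` + integrality
  have hup : Upper.AdditiveIMCUpperBDPOnTreeLeAt p κ 𝔭 γ (embAt K p 𝔭 h𝔭 he hf) (padicValNat p Dt.c.natAbs) P :=
    additiveIMCUpperBDPOnTreeLeAt_of_hasCharValuationAt_zero_of_frameValue _ P h0 hu hval hlog hc0
  -- LOWER socket from Kriz–Li Thm. 1.20 by name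
  have h2 : ∀ ℓ : ℕ, (hℓ : ℓ.Prime) → ¬ (haveI := Fact.mk hℓ; W.HasSplitMultiplicativeReductionAtPrime ℓ) :=
    fun ℓ hℓ hsp ↦ by
      haveI := Fact.mk hℓ
      exact W.not_hasMultiplicativeReductionAtPrime_of_hasCM hCM ℓ hsp.hasMultiplicativeReductionAtPrime
  have hlow : AdditiveIMCLowerBDPOnTreeLeAt p κ 𝔭 γ (embAt K p 𝔭 h𝔭 he hf) (padicValNat p Dt.c.natAbs) P := by
    subst hN
    haveI : NeZero (NumberField.discr K).natAbs := ⟨Int.natAbs_ne_zero.mpr (NumberField.discr_ne_zero K)⟩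
    have hsplit : ((Ideal.span {(p : ℤ)}).primesOver (𝓞 K)).ncard = 2 := hHN p hp hpN
    have hne := hKL p hp2 W f ψ ω hψ hω hss h1 h1' h2 h3 Dt K hK hHN hsplit εK hεK H ι (embAt K p 𝔭 h𝔭 he hf) P hP h4
    exact additiveIMCLowerBDPOnTreeLeAt_of_hasCharValuationAt_zero_of_krizLi _ P h0 hadd hne
  exact ⟨SchneiderFreeAdditiveX3.indexLowerBoundLeAt_of_imcLowerLe_of_control hN hK hHN hfin hlow hCtl,
    Upper.indexUpperBoundLeAt_of_imcUpperLe_of_control hN hK hHN hfin hup hCtl⟩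

end Halves


end Summit.BirchSwinnertonDyer.BirchSwinnertonDyer.Theorems.PrintCFram.GenusInternal

end
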